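import Mathlib
import HarnessLib
import Literature.Analysis.Convex.KrasnoselskijIteration
import Literature.Analysis.Convex.ConvexMetricProjection

/-!
# Monotone operators, firmly nonexpansive operators and resolvents (Eckstein–Bertsekas 1992, §2–§3)

Literature anchor (statements and proofs follow the source; nothing here is new mathematics):

* [EB92] J. Eckstein, D. P. Bertsekas, *On the Douglas–Rachford splitting method and the proximal
  point algorithm for maximal monotone operators*, Math. Programming **55** (1992) 293–318,
  doi:10.1007/BF01581204 (bib key `EcksteinBertsekas1992`; held copy, `lit` key
  `paper:doi-10-1007-bf01581204`, journal page = PDF page + 292): §2 "Monotone operators",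
  pp. 295–298 (operators as subsets of `𝓗 × 𝓗`, Theorem 1 (Minty), resolvents, Lemma 1,
  Theorem 2, Corollaries 2.1–2.3, `zer`, Lemma 2) and §3 "A generalized proximal point
  algorithm", Theorem 3, pp. 298–302.
* [Ber07] V. Berinde, *Iterative Approximation of Fixed Points*, LNM 1912, Springer 2007, Ch. 3,
  Thm 3.2 (Krasnoselskij's theorem) — used through
  `Literature.Analysis.Convex.KrasnoselskijIteration` (bib key `Berinde2007`).

THE SETTING [EB92, §2, p. 295].  "An operator `T` on a Hilbert space `𝓗` is a (possibly
null-valued) point-to-set map … We will make no distinction between an operator `T` and its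
graph, that is, the set `{(x, y) | y ∈ T(x)}`.  Thus, we may simply say that an operator is any
subset `T` of `𝓗 × 𝓗`."  Accordingly an operator is here a `Set (H × H)` over a real inner
product space `H`; `dom T`, `im T`, the inverse `T⁻¹ = {(y, x) | (x, y) ∈ T}`, `cT = {(x, cy)}`,
`A + B = {(x, y + z) | (x, y) ∈ A, (x, z) ∈ B}`, the identity `I = {(x, x)}`, monotonicity
`⟨x' − x, y' − y⟩ ≥ 0`, maximality, the resolvent `J_{cT} = (I + cT)⁻¹ = {(x + cy, x) | (x, y) ∈ T}`
(p. 296 and the "direct calculation" in the proof of Lemma 2, p. 298), nonexpansive and firmly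
nonexpansive operators (p. 296), and `zer(T) = T⁻¹(0)` (p. 298) are transcribed literally.

## What is formalised (namespace `Literature.Analysis.Convex.MonotoneOperator`)

* The vocabulary of [EB92, §2]: `dom`, `im`, `HasFullDomain`, `inv`, `cmul`, `opSum`, `idOp`,
  `graph` (a single-valued map `H → H` as an operator), `zer`, `IsMonotone`, `IsMaximalMonotone`,
  `resolvent` (with `resolvent_eq_inv_opSum : J_{cT} = (I + cT)⁻¹`), `IsNonexpansive`,
  `IsFirmlyNonexpansive`, `IsSingleValued`, and the derived operators `reflect` (`2J − I`),
  `idSub` (`I − J`), `halfAvgId` (`½(C + I)`), `invSubId` (`K⁻¹ − I`).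
* Lemma 1 (i)–(iv) [EB92, p. 296]: `IsFirmlyNonexpansive.isNonexpansive`,
  `isFirmlyNonexpansive_iff_isNonexpansive_reflect`,
  `isFirmlyNonexpansive_iff_exists_halfAvgId`, `isFirmlyNonexpansive_idSub_iff`; and
  `IsNonexpansive.isSingleValued` ("nonexpansive operators are necessarily single-valued").
* Theorem 2, first part [EB92, p. 296–297]: `isMonotone_iff_isFirmlyNonexpansive_resolvent`
  (`T` monotone iff `J_{cT}` firmly nonexpansive, `c > 0`); the elementary half of Theorem 1 /
  Theorem 2, second part: `isMaximalMonotone_of_forall_exists` (a monotone `T` with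
  `im(I + cT) = 𝓗` is maximal); Corollary 2.1 (`isFirmlyNonexpansive_iff_isMonotone_invSubId`,
  via `resolvent_one_invSubId : J_{K⁻¹ − I} = K`), Corollary 2.2 (`isSingleValued_resolvent`),
  Corollary 2.3, the Representation Lemma (`IsMonotone.eq_of_add_smul_eq`), Lemma 2
  (`mem_zer_iff_mem_resolvent`: `0 ∈ Tx ⟺ (x, x) ∈ J_{cT}`); in the converse direction of
  Corollary 2.1, `isMaximalMonotone_invSubId` (`K` firmly nonexpansive with full domain ⇒
  `K⁻¹ − I` maximal monotone).
* FUNCTION FORM.  Algorithms evaluate resolvents as maps; `IsResolventMap c T j` says that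
  `j : H → H` is a selection of `J_{cT}` defined everywhere (`(z, j z) ∈ J_{cT}` for all `z`), i.e.
  `J_{cT}` has full domain and — `T` monotone, Cor. 2.2 — `graph j = J_{cT}`
  (`IsResolventMap.graph_eq`).  In this form: `IsResolventMap.apply_add_smul`
  (`J_{cT}(x + cy) = x` for `(x, y) ∈ T`, [EB92, p. 303]), firm nonexpansiveness
  `IsResolventMap.norm_sub_sq_le_inner`, nonexpansiveness of `j` and of the reflection `2j − I`
  (`IsResolventMap.norm_sub_le`, `IsResolventMap.norm_reflect_sub_le`), continuity, Lemma 2 as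
  `IsResolventMap.apply_eq_self_iff` (`j z = z ⟺ z ∈ zer T`), and
  `exists_isResolventMap` (a resolvent map exists as soon as `im(I + cT) = 𝓗`).
* Theorem 3 [EB92, p. 299] in the following RESTRICTED form (constant stepsize `c`, constant
  relaxation factor `ρ ∈ (0, 2)`, exact evaluation of the resolvent, strong convergence on a
  proper — e.g. finite-dimensional — space): the relaxed proximal point iteration
  `z^{k+1} = (1 − ρ) z^k + ρ J_{cT}(z^k)` is the Krasnoselskij iteration `kmIter j ρ`, its key
  estimate `‖z^{k+1} − z*‖² ≤ ‖z^k − z*‖² − ρ(2 − ρ)‖z^k − J_{cT} z^k‖²` for `z* ∈ zer T` (the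
  second display of the proof, with `Q = I − J_{cT}` firmly nonexpansive by Lemma 1 (iv)) is
  `norm_averagedMap_resolvent_sub_sq_le`, and `exists_tendsto_kmIter_resolvent` concludes: if
  `zer T ≠ ∅` then `z^k` converges to a zero of `T` (through Krasnoselskij's theorem applied to
  the nonexpansive reflection `2J_{cT} − I` with parameter `ρ/2`, `kmIter_reflect`).

Everything is proved; there are no named facts and no `sorry`.

## Conventions and deviations

* SCALARS.  The source's `λ`/`c` is a real `c`; `c > 0` is assumed exactly where the source
  assumes it (Lemma 2 only needs `c ≠ 0`).
* MAXIMALITY AND MINTY'S THEOREM.  [EB92, Thm 1] (Minty: a monotone `T` is maximal iff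
  `im(I + T) = 𝓗`; "all proofs of the theorem require Zorn's lemma") is NOT formalised in the
  hard direction (maximal ⇒ surjective); only the elementary direction is
  (`isMaximalMonotone_of_forall_exists`).  Consequently every statement downstream that the
  source makes for "maximal monotone `T`" is made here for a monotone `T` together with a
  resolvent map `j` (`IsResolventMap c T j`), which is exactly what maximality provides through
  Theorem 1 and Corollary 2.2 (for the normal cone operator of a nonempty complete convex set the
  resolvent map is the metric projection, constructed outright in the companion anchor on
  [EB92, §4], Douglas–Rachford splitting).  Corollary 2.4 (the bijection) is not stated
  separately.
* THEOREM 3 is formalised only in the restricted form above: no summable error sequence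
  `ε_k`, no varying `ρ_k`, `c_k`, weak = strong convergence (proper space), and the
  unboundedness assertion for `zer T = ∅` is not formalised.
-/

noncomputable section

open Filter Topology
open scoped RealInnerProductSpace
open Literature.Analysis.Convex.KrasnoselskijIteration
open Literature.Analysis.Convex.ConvexMetricProjection

namespace Literature.Analysis.Convex.MonotoneOperator

variable {H : Type*} [NormedAddCommGroup H] [InnerProductSpace ℝ H]

/-! ## Operators as subsets of `H × H` [EB92, §2, p. 295–296] -/

/-- The domain `dom T = {x | ∃ y, (x, y) ∈ T} = {x | Tx ≠ ∅}` of an operator.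
[cite: EcksteinBertsekas1992, §2 p. 295] -/
def dom (T : Set (H × H)) : Set H := {x | ∃ y, (x, y) ∈ T}

/-- The range or image `im T = {y | ∃ x, (x, y) ∈ T}`. [cite: EcksteinBertsekas1992, §2 p. 295] -/
def im (T : Set (H × H)) : Set H := {y | ∃ x, (x, y) ∈ T}

/-- `T` has full domain if `dom T = 𝓗`. [cite: EcksteinBertsekas1992, §2 p. 295] -/
def HasFullDomain (T : Set (H × H)) : Prop := ∀ x, ∃ y, (x, y) ∈ T

/-- The inverse `T⁻¹ = {(y, x) | (x, y) ∈ T}`. [cite: EcksteinBertsekas1992, §2 p. 295] -/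
def inv (T : Set (H × H)) : Set (H × H) := {p | (p.2, p.1) ∈ T}

/-- The scaled operator `cT = {(x, cy) | (x, y) ∈ T}`. [cite: EcksteinBertsekas1992, §2 p. 295] -/
def cmul (c : ℝ) (T : Set (H × H)) : Set (H × H) := {p | ∃ y, (p.1, y) ∈ T ∧ p.2 = c • y}

/-- The sum `A + B = {(x, y + z) | (x, y) ∈ A, (x, z) ∈ B}`.
[cite: EcksteinBertsekas1992, §2 p. 295] -/
def opSum (A B : Set (H × H)) : Set (H × H) :=
  {p | ∃ y z, (p.1, y) ∈ A ∧ (p.1, z) ∈ B ∧ p.2 = y + z}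

/-- The identity operator `I = {(x, x) | x ∈ 𝓗}`. [cite: EcksteinBertsekas1992, §2 p. 295] -/
def idOp : Set (H × H) := {p | p.2 = p.1}

/-- A single-valued everywhere-defined map `f : 𝓗 → 𝓗` regarded as an operator (its graph
`{(x, f x)}`; the source identifies the two, p. 295). [cite: EcksteinBertsekas1992, §2 p. 295] -/
def graph (f : H → H) : Set (H × H) := {p | p.2 = f p.1}

/-- The zeroes `zer(T) = T⁻¹(0) = {x | 0 ∈ Tx}`. [cite: EcksteinBertsekas1992, §2 p. 298] -/
def zer (T : Set (H × H)) : Set H := {x | (x, (0 : H)) ∈ T}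

/-- `T` is monotone: `⟨x' − x, y' − y⟩ ≥ 0` for all `(x, y), (x', y') ∈ T`.
[cite: EcksteinBertsekas1992, §2 p. 295] -/
def IsMonotone (T : Set (H × H)) : Prop :=
  ∀ ⦃x y : H⦄, (x, y) ∈ T → ∀ ⦃x' y' : H⦄, (x', y') ∈ T → 0 ≤ ⟪x' - x, y' - y⟫

/-- A monotone operator is maximal if (as a graph) it is not strictly contained in any other
monotone operator. [cite: EcksteinBertsekas1992, §2 p. 296] -/
def IsMaximalMonotone (T : Set (H × H)) : Prop :=
  IsMonotone T ∧ ∀ ⦃T' : Set (H × H)⦄, IsMonotone T' → T ⊆ T' → T' ⊆ T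

/-- The resolvent `J_{cT} = (I + cT)⁻¹ = {(x + cy, x) | (x, y) ∈ T}` ("by direct calculation",
proof of Lemma 2). [cite: EcksteinBertsekas1992, §2 p. 296 and p. 298] -/
def resolvent (c : ℝ) (T : Set (H × H)) : Set (H × H) :=
  {p | ∃ y, (p.2, y) ∈ T ∧ p.2 + c • y = p.1}

/-- `C` is nonexpansive: `‖y' − y‖ ≤ ‖x' − x‖` for all `(x, y), (x', y') ∈ C`.
[cite: EcksteinBertsekas1992, §2 p. 296] -/
def IsNonexpansive (C : Set (H × H)) : Prop :=
  ∀ ⦃x y : H⦄, (x, y) ∈ C → ∀ ⦃x' y' : H⦄, (x', y') ∈ C → ‖y' - y‖ ≤ ‖x' - x‖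

/-- `J` is firmly nonexpansive: `‖y' − y‖² ≤ ⟨x' − x, y' − y⟩` for all `(x, y), (x', y') ∈ J`.
[cite: EcksteinBertsekas1992, §2 p. 296] -/
def IsFirmlyNonexpansive (J : Set (H × H)) : Prop :=
  ∀ ⦃x y : H⦄, (x, y) ∈ J → ∀ ⦃x' y' : H⦄, (x', y') ∈ J → ‖y' - y‖ ^ 2 ≤ ⟪x' - x, y' - y⟫

/-- `T` is single-valued: the cardinality of `Tx` is at most one for every `x`.
[cite: EcksteinBertsekas1992, §2 p. 295] -/
def IsSingleValued (T : Set (H × H)) : Prop :=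
  ∀ ⦃x y y' : H⦄, (x, y) ∈ T → (x, y') ∈ T → y = y'

/-- The operator `2J − I = {(x, 2y − x) | (x, y) ∈ J}` of Lemma 1 (ii).
[cite: EcksteinBertsekas1992, §2 Lemma 1] -/
def reflect (J : Set (H × H)) : Set (H × H) := {p | ∃ y, (p.1, y) ∈ J ∧ p.2 = (2 : ℝ) • y - p.1}

/-- The operator `I − J = {(x, x − y) | (x, y) ∈ J}` of Lemma 1 (iv).
[cite: EcksteinBertsekas1992, §2 Lemma 1] -/
def idSub (J : Set (H × H)) : Set (H × H) := {p | ∃ y, (p.1, y) ∈ J ∧ p.2 = p.1 - y}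

/-- The operator `½(C + I) = {(x, ½(y + x)) | (x, y) ∈ C}` of Lemma 1 (iii).
[cite: EcksteinBertsekas1992, §2 Lemma 1] -/
def halfAvgId (C : Set (H × H)) : Set (H × H) :=
  {p | ∃ y, (p.1, y) ∈ C ∧ p.2 = (1 / 2 : ℝ) • (y + p.1)}

/-- The operator `K⁻¹ − I = {(y, x − y) | (x, y) ∈ K}` of Corollary 2.1.
[cite: EcksteinBertsekas1992, §2 Cor 2.1] -/
def invSubId (K : Set (H × H)) : Set (H × H) := {p | ∃ x, (x, p.1) ∈ K ∧ p.2 = x - p.1}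

variable {T A B C J K : Set (H × H)} {c : ℝ} {x y x' y' z z' : H}

/-! ## Membership lemmas -/

/-- `(z, x) ∈ J_{cT} ⟺ ∃ y ∈ Tx, x + cy = z`. [cite: EcksteinBertsekas1992, §2 p. 298] -/
theorem mem_resolvent_iff : (z, x) ∈ resolvent c T ↔ ∃ y, (x, y) ∈ T ∧ x + c • y = z := Iff.rfl

/-- `(x, y) ∈ T ⟹ (x + cy, x) ∈ J_{cT} = (I + cT)⁻¹` (first display of the proof of Theorem 2).
[cite: EcksteinBertsekas1992, §2 Thm 2] -/
theorem mem_resolvent_of_mem (c : ℝ) (h : (x, y) ∈ T) : (x + c • y, x) ∈ resolvent c T :=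
  ⟨y, h, rfl⟩

omit [InnerProductSpace ℝ H] in
/-- `x ∈ zer T ⟺ (x, 0) ∈ T`. [cite: EcksteinBertsekas1992, §2 p. 298] -/
theorem mem_zer_iff : x ∈ zer T ↔ (x, (0 : H)) ∈ T := Iff.rfl

omit [NormedAddCommGroup H] [InnerProductSpace ℝ H] in
/-- `(x, y) ∈ graph f ⟺ y = f x`. [cite: EcksteinBertsekas1992, §2 p. 295] -/
theorem mem_graph_iff {f : H → H} : (x, y) ∈ graph f ↔ y = f x := Iff.rfl

/-- `(x, w) ∈ 2J − I ⟺ w = 2y − x` for some `y ∈ Jx`. [cite: EcksteinBertsekas1992, §2 Lemma 1] -/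
theorem mem_reflect_iff {w : H} : (x, w) ∈ reflect J ↔ ∃ y, (x, y) ∈ J ∧ w = (2 : ℝ) • y - x :=
  Iff.rfl

omit [InnerProductSpace ℝ H] in
/-- `(x, w) ∈ I − J ⟺ w = x − y` for some `y ∈ Jx`. [cite: EcksteinBertsekas1992, §2 Lemma 1] -/
theorem mem_idSub_iff {w : H} : (x, w) ∈ idSub J ↔ ∃ y, (x, y) ∈ J ∧ w = x - y := Iff.rfl

/-- `(x, w) ∈ ½(C + I) ⟺ w = ½(y + x)` for some `y ∈ Cx`. [cite: EcksteinBertsekas1992, §2 Lemma 1] -/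
theorem mem_halfAvgId_iff {w : H} :
    (x, w) ∈ halfAvgId C ↔ ∃ y, (x, y) ∈ C ∧ w = (1 / 2 : ℝ) • (y + x) := Iff.rfl

omit [InnerProductSpace ℝ H] in
/-- `(y, w) ∈ K⁻¹ − I ⟺ w = x − y` for some `x` with `(x, y) ∈ K`.
[cite: EcksteinBertsekas1992, §2 Cor 2.1] -/
theorem mem_invSubId_iff {w : H} : (y, w) ∈ invSubId K ↔ ∃ x, (x, y) ∈ K ∧ w = x - y := Iff.rfl

omit [InnerProductSpace ℝ H] in
/-- `x ∈ zer(A + B) ⟺ ∃ b ∈ Bx, −b ∈ Ax` (used in Theorem 5 of §4).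
[cite: EcksteinBertsekas1992, §2 p. 295 and §4 Thm 5] -/
theorem mem_zer_opSum_iff : x ∈ zer (opSum A B) ↔ ∃ b, (x, b) ∈ B ∧ (x, -b) ∈ A := by
  constructor
  · rintro ⟨y, b, hy, hb, h0⟩
    have : y = -b := eq_neg_of_add_eq_zero_left h0.symm
    exact ⟨b, hb, this ▸ hy⟩
  · rintro ⟨b, hb, ha⟩
    exact ⟨-b, b, ha, hb, (neg_add_cancel b).symm⟩

/-- The resolvent IS `(I + cT)⁻¹` in the operator calculus of §2: inverse of the sum of the
identity and the scaled operator. [cite: EcksteinBertsekas1992, §2 p. 296] -/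
theorem resolvent_eq_inv_opSum (c : ℝ) (T : Set (H × H)) :
    resolvent c T = inv (opSum idOp (cmul c T)) := by
  ext ⟨z, x⟩
  simp only [resolvent, inv, opSum, idOp, cmul, Set.mem_setOf_eq]
  constructor
  · rintro ⟨y, hy, rfl⟩
    exact ⟨x, c • y, rfl, ⟨y, hy, rfl⟩, rfl⟩
  · rintro ⟨y, w, rfl, ⟨v, hv, rfl⟩, rfl⟩
    exact ⟨v, hv, rfl⟩

/-- `dom J_{cT} = im(I + cT)`: `z ∈ dom J_{cT} ⟺ z = x + cy` for some `(x, y) ∈ T` (proof of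
Theorem 2, last paragraph). [cite: EcksteinBertsekas1992, §2 Thm 2] -/
theorem mem_dom_resolvent_iff : z ∈ dom (resolvent c T) ↔ ∃ x y, (x, y) ∈ T ∧ x + c • y = z := by
  simp only [dom, resolvent, Set.mem_setOf_eq]

omit [NormedAddCommGroup H] [InnerProductSpace ℝ H] in
/-- The identity map as an operator is `I`. [cite: EcksteinBertsekas1992, §2 p. 295] -/
theorem graph_id : graph (id : H → H) = idOp := rfl

omit [NormedAddCommGroup H] [InnerProductSpace ℝ H] in
/-- An operator given by a map is single-valued. [cite: EcksteinBertsekas1992, §2 p. 295] -/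
theorem isSingleValued_graph (f : H → H) : IsSingleValued (graph f) := by
  intro x y y' hy hy'
  rw [mem_graph_iff] at hy hy'
  rw [hy, hy']

omit [NormedAddCommGroup H] [InnerProductSpace ℝ H] in
/-- A map, as an operator, has full domain. [cite: EcksteinBertsekas1992, §2 p. 295] -/
theorem hasFullDomain_graph (f : H → H) : HasFullDomain (graph f) := fun x => ⟨f x, rfl⟩

/-! ## Lemma 1 [EB92, p. 296] -/

omit [InnerProductSpace ℝ H] in
/-- "Nonexpansive operators are necessarily single-valued."
[cite: EcksteinBertsekas1992, §2 p. 296] -/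
theorem IsNonexpansive.isSingleValued (hC : IsNonexpansive C) : IsSingleValued C := by
  intro x y y' hy hy'
  have h := hC hy hy'
  rw [sub_self, norm_zero, norm_le_zero_iff, sub_eq_zero] at h
  exact h.symm

/-- **Lemma 1 (i)**: all firmly nonexpansive operators are nonexpansive.
[cite: EcksteinBertsekas1992, §2 Lemma 1 (i)] -/
theorem IsFirmlyNonexpansive.isNonexpansive (hJ : IsFirmlyNonexpansive J) : IsNonexpansive J := by
  intro x y hxy x' y' hxy'
  have h := hJ hxy hxy'
  have hsq : ‖y' - y‖ ^ 2 ≤ ‖x' - x‖ ^ 2 := by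
    have e : ‖(x' - x) - (y' - y)‖ ^ 2 = ‖x' - x‖ ^ 2 - 2 * ⟪x' - x, y' - y⟫ + ‖y' - y‖ ^ 2 :=
      norm_sub_sq_real _ _
    nlinarith [sq_nonneg ‖(x' - x) - (y' - y)‖, e]
  exact (sq_le_sq₀ (norm_nonneg _) (norm_nonneg _)).1 hsq

/-- A firmly nonexpansive operator is single-valued (Lemma 1 (i) and the remark before it).
[cite: EcksteinBertsekas1992, §2 Lemma 1 (i)] -/
theorem IsFirmlyNonexpansive.isSingleValued (hJ : IsFirmlyNonexpansive J) : IsSingleValued J :=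
  hJ.isNonexpansive.isSingleValued

/-- The computation behind Lemma 1 (ii): `‖(2y' − x') − (2y − x)‖² = 4‖y' − y‖² − 4⟨x' − x, y' − y⟩
+ ‖x' − x‖²`. [cite: EcksteinBertsekas1992, §2 Lemma 1 (ii)] -/
theorem norm_reflect_sub_sq (x y x' y' : H) :
    ‖((2 : ℝ) • y' - x') - ((2 : ℝ) • y - x)‖ ^ 2
      = 4 * ‖y' - y‖ ^ 2 - 4 * ⟪x' - x, y' - y⟫ + ‖x' - x‖ ^ 2 := by
  have e : ((2 : ℝ) • y' - x') - ((2 : ℝ) • y - x) = (2 : ℝ) • (y' - y) - (x' - x) := by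
    simp only [smul_sub]; abel
  rw [e, norm_sub_sq_real, norm_smul, real_inner_smul_left, Real.norm_eq_abs,
    abs_of_pos (by norm_num : (0 : ℝ) < 2), mul_pow, real_inner_comm]
  ring

/-- **Lemma 1 (ii)**: `J` is firmly nonexpansive iff `2J − I` is nonexpansive.
[cite: EcksteinBertsekas1992, §2 Lemma 1 (ii)] -/
theorem isFirmlyNonexpansive_iff_isNonexpansive_reflect :
    IsFirmlyNonexpansive J ↔ IsNonexpansive (reflect J) := by
  constructor
  · intro hJ x w hw x' w' hw'
    obtain ⟨y, hy, rfl⟩ := mem_reflect_iff.1 hw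
    obtain ⟨y', hy', rfl⟩ := mem_reflect_iff.1 hw'
    have h := hJ hy hy'
    have hsq : ‖((2 : ℝ) • y' - x') - ((2 : ℝ) • y - x)‖ ^ 2 ≤ ‖x' - x‖ ^ 2 := by
      rw [norm_reflect_sub_sq]; nlinarith [h]
    exact (sq_le_sq₀ (norm_nonneg _) (norm_nonneg _)).1 hsq
  · intro hR x y hy x' y' hy'
    have h := hR (mem_reflect_iff.2 ⟨y, hy, rfl⟩) (mem_reflect_iff.2 ⟨y', hy', rfl⟩)
    have hsq : ‖((2 : ℝ) • y' - x') - ((2 : ℝ) • y - x)‖ ^ 2 ≤ ‖x' - x‖ ^ 2 :=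
      (sq_le_sq₀ (norm_nonneg _) (norm_nonneg _)).2 h
    rw [norm_reflect_sub_sq] at hsq
    nlinarith [hsq]

/-- `½((2J − I) + I) = J`. [cite: EcksteinBertsekas1992, §2 Lemma 1 (iii)] -/
theorem halfAvgId_reflect (J : Set (H × H)) : halfAvgId (reflect J) = J := by
  ext ⟨x, y⟩
  simp only [halfAvgId, reflect, Set.mem_setOf_eq]
  constructor
  · rintro ⟨w, ⟨v, hv, rfl⟩, h⟩
    have : y = v := by
      rw [h, sub_add_cancel, smul_smul]; norm_num
    rwa [this]
  · intro hy
    refine ⟨(2 : ℝ) • y - x, ⟨y, hy, rfl⟩, ?_⟩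
    rw [sub_add_cancel, smul_smul]; norm_num

/-- **Lemma 1 (iii)**: an operator is firmly nonexpansive iff it is of the form `½(C + I)` with
`C` nonexpansive. [cite: EcksteinBertsekas1992, §2 Lemma 1 (iii)] -/
theorem isFirmlyNonexpansive_iff_exists_halfAvgId :
    IsFirmlyNonexpansive J ↔ ∃ C : Set (H × H), IsNonexpansive C ∧ J = halfAvgId C := by
  constructor
  · intro hJ
    exact ⟨reflect J, isFirmlyNonexpansive_iff_isNonexpansive_reflect.1 hJ,
      (halfAvgId_reflect J).symm⟩
  · rintro ⟨C, hC, rfl⟩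
    intro x w hw x' w' hw'
    obtain ⟨y, hy, rfl⟩ := mem_halfAvgId_iff.1 hw
    obtain ⟨y', hy', rfl⟩ := mem_halfAvgId_iff.1 hw'
    have h := hC hy hy'
    have hsq : ‖y' - y‖ ^ 2 ≤ ‖x' - x‖ ^ 2 := (sq_le_sq₀ (norm_nonneg _) (norm_nonneg _)).2 h
    have e : (1 / 2 : ℝ) • (y' + x') - (1 / 2 : ℝ) • (y + x) = (1 / 2 : ℝ) • ((y' - y) + (x' - x)) := by
      simp only [smul_add, smul_sub]; abel
    rw [e, norm_smul, real_inner_smul_right, Real.norm_eq_abs,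
      abs_of_pos (by norm_num : (0 : ℝ) < 1 / 2), mul_pow, norm_add_sq_real, inner_add_right,
      real_inner_self_eq_norm_sq, real_inner_comm]
    nlinarith [hsq]

omit [InnerProductSpace ℝ H] in
/-- `I − (I − J) = J`. [cite: EcksteinBertsekas1992, §2 Lemma 1 (iv)] -/
theorem idSub_idSub (J : Set (H × H)) : idSub (idSub J) = J := by
  ext ⟨x, y⟩
  simp only [idSub, Set.mem_setOf_eq]
  constructor
  · rintro ⟨w, ⟨v, hv, rfl⟩, h⟩
    rw [h, sub_sub_cancel]; exact hv
  · intro hy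
    exact ⟨x - y, ⟨y, hy, rfl⟩, (sub_sub_cancel x y).symm⟩

/-- One direction of Lemma 1 (iv), pointwise: `‖y' − y‖² ≤ ⟨x' − x, y' − y⟩` implies
`‖(x' − y') − (x − y)‖² ≤ ⟨x' − x, (x' − y') − (x − y)⟩`.
[cite: EcksteinBertsekas1992, §2 Lemma 1 (iv)] -/
theorem norm_sub_sub_sq_le_inner_of_le (h : ‖y' - y‖ ^ 2 ≤ ⟪x' - x, y' - y⟫) :
    ‖(x' - y') - (x - y)‖ ^ 2 ≤ ⟪x' - x, (x' - y') - (x - y)⟫ := by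
  have e : (x' - y') - (x - y) = (x' - x) - (y' - y) := by abel
  have e2 : ⟪x' - x, (x' - x) - (y' - y)⟫ = ‖x' - x‖ ^ 2 - ⟪x' - x, y' - y⟫ := by
    rw [inner_sub_right, real_inner_self_eq_norm_sq]
  rw [e, e2, norm_sub_sq_real]
  linarith

/-- **Lemma 1 (iv)**: `J` is firmly nonexpansive iff `I − J` is firmly nonexpansive.
[cite: EcksteinBertsekas1992, §2 Lemma 1 (iv)] -/
theorem isFirmlyNonexpansive_idSub_iff : IsFirmlyNonexpansive (idSub J) ↔ IsFirmlyNonexpansive J := by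
  suffices key : ∀ K : Set (H × H), IsFirmlyNonexpansive K → IsFirmlyNonexpansive (idSub K) by
    refine ⟨fun h => ?_, key J⟩
    rw [← idSub_idSub J]
    exact key _ h
  intro K hK x w hw x' w' hw'
  obtain ⟨y, hy, rfl⟩ := mem_idSub_iff.1 hw
  obtain ⟨y', hy', rfl⟩ := mem_idSub_iff.1 hw'
  exact norm_sub_sub_sq_le_inner_of_le (hK hy hy')

/-! ## Theorem 2 and its corollaries [EB92, pp. 296–298] -/

/-- **Theorem 2 (first part)**: for `c > 0`, `T` is monotone iff its resolvent
`J_{cT} = (I + cT)⁻¹` is firmly nonexpansive. [cite: EcksteinBertsekas1992, §2 Thm 2] -/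
theorem isMonotone_iff_isFirmlyNonexpansive_resolvent (hc : 0 < c) :
    IsMonotone T ↔ IsFirmlyNonexpansive (resolvent c T) := by
  constructor
  · intro hT z x hzx z' x' hzx'
    obtain ⟨y, hxy, rfl⟩ := mem_resolvent_iff.1 hzx
    obtain ⟨y', hxy', rfl⟩ := mem_resolvent_iff.1 hzx'
    have h := hT hxy hxy'
    have e : (x' + c • y') - (x + c • y) = (x' - x) + c • (y' - y) := by
      simp only [smul_sub]; abel
    rw [e, inner_add_left, real_inner_self_eq_norm_sq, real_inner_smul_left,
      real_inner_comm (x' - x) (y' - y)]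
    nlinarith [mul_nonneg hc.le h]
  · intro hJ x y hxy x' y' hxy'
    have h := hJ (mem_resolvent_of_mem c hxy) (mem_resolvent_of_mem c hxy')
    have e : (x' + c • y') - (x + c • y) = (x' - x) + c • (y' - y) := by
      simp only [smul_sub]; abel
    rw [e, inner_add_left, real_inner_self_eq_norm_sq, real_inner_smul_left,
      real_inner_comm (x' - x) (y' - y)] at h
    by_contra hneg
    have := mul_neg_of_pos_of_neg hc (lt_of_not_ge hneg)
    linarith

/-- **Corollary 2.2**: for `c > 0` the resolvent of a monotone operator is single-valued.
[cite: EcksteinBertsekas1992, §2 Cor 2.2] -/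
theorem isSingleValued_resolvent (hT : IsMonotone T) (hc : 0 < c) :
    IsSingleValued (resolvent c T) :=
  ((isMonotone_iff_isFirmlyNonexpansive_resolvent hc).1 hT).isSingleValued

/-- **Corollary 2.3 (the Representation Lemma)**: for `c > 0` and `T` monotone, every `z` can be
written in at most one way as `x + cy` with `y ∈ Tx`. [cite: EcksteinBertsekas1992, §2 Cor 2.3] -/
theorem IsMonotone.eq_of_add_smul_eq (hT : IsMonotone T) (hc : 0 < c) (h : (x, y) ∈ T)
    (h' : (x', y') ∈ T) (e : x + c • y = x' + c • y') : x = x' ∧ y = y' := by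
  have hx : x = x' :=
    (isSingleValued_resolvent hT hc) (mem_resolvent_of_mem c h) (e ▸ mem_resolvent_of_mem c h')
  refine ⟨hx, ?_⟩
  subst hx
  have : c • y = c • y' := add_left_cancel e
  exact smul_right_injective H hc.ne' this

/-- **Theorem 1 (⇐) / Theorem 2 (second part, ⇐)**, the elementary direction of Minty's
theorem: a monotone operator `T` with `im(I + cT) = 𝓗` for some `c > 0` (equivalently:
`J_{cT}` has full domain) is maximal monotone. [cite: EcksteinBertsekas1992, §2 Thm 1 and Thm 2] -/
theorem isMaximalMonotone_of_forall_exists (hT : IsMonotone T) (hc : 0 < c)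
    (h : ∀ z : H, ∃ x y, (x, y) ∈ T ∧ x + c • y = z) : IsMaximalMonotone T := by
  refine ⟨hT, fun T' hT' hsub => ?_⟩
  rintro ⟨x', y'⟩ hmem'
  obtain ⟨x, y, hxy, e⟩ := h (x' + c • y')
  have hmono := hT' (hsub hxy) hmem'
  have ex : x' - x = c • (y - y') := by
    rw [smul_sub]
    have : x = x' + c • y' - c • y := eq_sub_of_add_eq e
    rw [this]; abel
  rw [ex, real_inner_smul_left] at hmono
  have hneg : ⟪y - y', y' - y⟫ = -‖y' - y‖ ^ 2 := by
    rw [← neg_sub y' y, inner_neg_left, real_inner_self_eq_norm_sq]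
  rw [hneg] at hmono
  have hsq : ‖y' - y‖ ^ 2 ≤ 0 := by nlinarith [hmono, sq_nonneg ‖y' - y‖]
  have hy : y' = y := by
    have : ‖y' - y‖ ^ 2 = 0 := le_antisymm hsq (sq_nonneg _)
    rwa [sq_eq_zero_iff, norm_eq_zero, sub_eq_zero] at this
  subst hy
  have hx : x' = x := by
    have : x' - x = 0 := by rw [ex, sub_self, smul_zero]
    exact sub_eq_zero.1 this
  subst hx
  exact hxy

/-- `J_{1·(K⁻¹ − I)} = K`: the resolvent (with `c = 1`) of `K⁻¹ − I` is `K` itself (the computation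
behind Corollary 2.1). [cite: EcksteinBertsekas1992, §2 Cor 2.1] -/
theorem resolvent_one_invSubId (K : Set (H × H)) : resolvent 1 (invSubId K) = K := by
  ext ⟨z, x⟩
  simp only [resolvent, invSubId, Set.mem_setOf_eq, one_smul]
  constructor
  · rintro ⟨y, ⟨w, hw, rfl⟩, h⟩
    rw [add_sub_cancel] at h
    rwa [← h]
  · intro h
    exact ⟨z - x, ⟨z, h, rfl⟩, add_sub_cancel x z⟩

/-- **Corollary 2.1 (first part)**: `K` is firmly nonexpansive iff `K⁻¹ − I` is monotone.
[cite: EcksteinBertsekas1992, §2 Cor 2.1] -/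
theorem isFirmlyNonexpansive_iff_isMonotone_invSubId :
    IsFirmlyNonexpansive K ↔ IsMonotone (invSubId K) := by
  rw [isMonotone_iff_isFirmlyNonexpansive_resolvent one_pos, resolvent_one_invSubId]

/-- **Corollary 2.1 (second part, ⇐ direction of maximality)**: if `K` is firmly nonexpansive with
full domain then `K⁻¹ − I` is maximal monotone. [cite: EcksteinBertsekas1992, §2 Cor 2.1] -/
theorem isMaximalMonotone_invSubId (hK : IsFirmlyNonexpansive K) (hdom : HasFullDomain K) :
    IsMaximalMonotone (invSubId K) := by
  refine isMaximalMonotone_of_forall_exists (isFirmlyNonexpansive_iff_isMonotone_invSubId.1 hK)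
    one_pos fun z => ?_
  obtain ⟨x, hx⟩ := hdom z
  exact ⟨x, z - x, ⟨z, hx, rfl⟩, by rw [one_smul, add_sub_cancel]⟩

/-! ## Lemma 2: zeroes and fixed points of resolvents [EB92, p. 298] -/

/-- **Lemma 2**: `0 ∈ Tx ⟺ (x, x) ∈ J_{cT}` (for `c ≠ 0`; with `J_{cT}` single-valued this reads
`J_{cT}(x) = x`, see `IsResolventMap.apply_eq_self_iff`). [cite: EcksteinBertsekas1992, §2 Lemma 2] -/
theorem mem_zer_iff_mem_resolvent (hc : c ≠ 0) : x ∈ zer T ↔ (x, x) ∈ resolvent c T := by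
  rw [mem_zer_iff, mem_resolvent_iff]
  constructor
  · intro h
    exact ⟨0, h, by rw [smul_zero, add_zero]⟩
  · rintro ⟨y, hy, e⟩
    have : c • y = 0 := by
      have := e; nth_rw 2 [← add_zero x] at this
      exact add_left_cancel this
    rcases smul_eq_zero.1 this with h | h
    · exact absurd h hc
    · rwa [h] at hy

/-! ## Function form: resolvent maps -/

/-- `j : 𝓗 → 𝓗` is a (the) resolvent map of `T` with constant `c`: `(z, j z) ∈ J_{cT}` for every `z`,
i.e. `j` evaluates `J_{cT} = (I + cT)⁻¹`, which in particular has full domain (for a maximal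
monotone `T` such a `j` exists and is unique by Theorem 1 and Corollary 2.2).
[cite: EcksteinBertsekas1992, §2 Thm 2 and Cor 2.2] -/
def IsResolventMap (c : ℝ) (T : Set (H × H)) (j : H → H) : Prop := ∀ z, (z, j z) ∈ resolvent c T

variable {j : H → H}

/-- Unfolding: `j z ∈ 𝓗` comes with `y ∈ T(j z)` such that `j z + cy = z`.
[cite: EcksteinBertsekas1992, §2 Thm 2] -/
theorem IsResolventMap.exists_mem (hj : IsResolventMap c T j) (z : H) :
    ∃ y, (j z, y) ∈ T ∧ j z + c • y = z :=
  hj z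

/-- A resolvent map exists as soon as `im(I + cT) = 𝓗` (Theorem 2, second part; a choice of
preimages). [cite: EcksteinBertsekas1992, §2 Thm 2] -/
theorem exists_isResolventMap (h : ∀ z : H, ∃ x y, (x, y) ∈ T ∧ x + c • y = z) :
    ∃ j : H → H, IsResolventMap c T j := by
  choose f g hfg using h
  exact ⟨f, fun z => ⟨g z, (hfg z).1, (hfg z).2⟩⟩

/-- A resolvent map witnesses `im(I + cT) = 𝓗`. [cite: EcksteinBertsekas1992, §2 Thm 2] -/
theorem IsResolventMap.forall_exists (hj : IsResolventMap c T j) (z : H) :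
    ∃ x y, (x, y) ∈ T ∧ x + c • y = z :=
  let ⟨y, hy, e⟩ := hj.exists_mem z
  ⟨j z, y, hy, e⟩

/-- With a resolvent map, `J_{cT}` has full domain. [cite: EcksteinBertsekas1992, §2 Thm 2] -/
theorem IsResolventMap.hasFullDomain (hj : IsResolventMap c T j) : HasFullDomain (resolvent c T) :=
  fun z => ⟨j z, hj z⟩

/-- A monotone operator with a resolvent map (`c > 0`) is maximal monotone (Theorem 2, second
part, ⇐). [cite: EcksteinBertsekas1992, §2 Thm 2] -/
theorem IsResolventMap.isMaximalMonotone (hj : IsResolventMap c T j) (hT : IsMonotone T)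
    (hc : 0 < c) : IsMaximalMonotone T :=
  isMaximalMonotone_of_forall_exists hT hc hj.forall_exists

/-- For `T` monotone and `c > 0` the resolvent map is the whole resolvent: `(z, x) ∈ J_{cT}` iff
`x = j z` (Corollary 2.2). [cite: EcksteinBertsekas1992, §2 Cor 2.2] -/
theorem IsResolventMap.apply_eq (hj : IsResolventMap c T j) (hT : IsMonotone T) (hc : 0 < c)
    (h : (z, x) ∈ resolvent c T) : j z = x :=
  isSingleValued_resolvent hT hc (hj z) h

/-- `graph j = J_{cT}` for `T` monotone, `c > 0` (Corollary 2.2).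
[cite: EcksteinBertsekas1992, §2 Cor 2.2] -/
theorem IsResolventMap.graph_eq (hj : IsResolventMap c T j) (hT : IsMonotone T) (hc : 0 < c) :
    graph j = resolvent c T := by
  ext ⟨z, x⟩
  rw [mem_graph_iff]
  constructor
  · rintro rfl; exact hj z
  · intro h; exact (hj.apply_eq hT hc h).symm

/-- "If `(y, a) ∈ A`, then `J_{λA}(y + λa) = y`" (the Representation Lemma in use, §4 p. 303).
[cite: EcksteinBertsekas1992, §2 Cor 2.3 and §4 p. 303] -/
theorem IsResolventMap.apply_add_smul (hj : IsResolventMap c T j) (hT : IsMonotone T) (hc : 0 < c)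
    (h : (x, y) ∈ T) : j (x + c • y) = x :=
  hj.apply_eq hT hc (mem_resolvent_of_mem c h)

/-- The defining inclusion of a resolvent map: `(j z, c⁻¹(z − j z)) ∈ T`.
[cite: EcksteinBertsekas1992, §2 Thm 2] -/
theorem IsResolventMap.mem (hj : IsResolventMap c T j) (hc : c ≠ 0) (z : H) :
    (j z, c⁻¹ • (z - j z)) ∈ T := by
  obtain ⟨y, hy, e⟩ := hj.exists_mem z
  have : c⁻¹ • (z - j z) = y := by
    have e' : z - j z = c • y := sub_eq_of_eq_add' e.symm
    rw [e', smul_smul, inv_mul_cancel₀ hc, one_smul]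
  rwa [this]

/-- **Theorem 2 in function form**: the resolvent map of a monotone operator is firmly
nonexpansive, `‖j z' − j z‖² ≤ ⟨z' − z, j z' − j z⟩`. [cite: EcksteinBertsekas1992, §2 Thm 2] -/
theorem IsResolventMap.norm_sub_sq_le_inner (hj : IsResolventMap c T j) (hT : IsMonotone T)
    (hc : 0 < c) (z z' : H) : ‖j z' - j z‖ ^ 2 ≤ ⟪z' - z, j z' - j z⟫ :=
  (isMonotone_iff_isFirmlyNonexpansive_resolvent hc).1 hT (hj z) (hj z')

/-- The resolvent map of a monotone operator is nonexpansive (Lemma 1 (i)).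
[cite: EcksteinBertsekas1992, §2 Lemma 1 (i) and Thm 2] -/
theorem IsResolventMap.norm_sub_le (hj : IsResolventMap c T j) (hT : IsMonotone T) (hc : 0 < c)
    (z z' : H) : ‖j z' - j z‖ ≤ ‖z' - z‖ :=
  ((isMonotone_iff_isFirmlyNonexpansive_resolvent hc).1 hT).isNonexpansive (hj z) (hj z')

/-- The reflected resolvent `2J_{cT} − I` of a monotone operator is nonexpansive (Lemma 1 (ii)).
[cite: EcksteinBertsekas1992, §2 Lemma 1 (ii) and Thm 2] -/
theorem IsResolventMap.norm_reflect_sub_le (hj : IsResolventMap c T j) (hT : IsMonotone T)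
    (hc : 0 < c) (z z' : H) :
    ‖((2 : ℝ) • j z' - z') - ((2 : ℝ) • j z - z)‖ ≤ ‖z' - z‖ :=
  norm_two_smul_sub_le_of_sq_le_inner
    (fun a b => by rw [real_inner_comm]; exact hj.norm_sub_sq_le_inner hT hc b a) z' z

/-- `I − J_{cT}` is firmly nonexpansive in function form (Lemma 1 (iv)), the property of
`Q = I − J_{cT}` used in the proof of Theorem 3. [cite: EcksteinBertsekas1992, §2 Lemma 1 (iv)] -/
theorem IsResolventMap.norm_sub_sub_sq_le_inner (hj : IsResolventMap c T j) (hT : IsMonotone T)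
    (hc : 0 < c) (z z' : H) :
    ‖(z' - j z') - (z - j z)‖ ^ 2 ≤ ⟪z' - z, (z' - j z') - (z - j z)⟫ :=
  norm_sub_sub_sq_le_inner_of_le (hj.norm_sub_sq_le_inner hT hc z z')

/-- A resolvent map of a monotone operator is (Lipschitz) continuous ("nonexpansive operators are
… Lipschitz continuous", p. 296). [cite: EcksteinBertsekas1992, §2 p. 296] -/
theorem IsResolventMap.continuous (hj : IsResolventMap c T j) (hT : IsMonotone T) (hc : 0 < c) :
    Continuous j :=
  (LipschitzWith.of_dist_le_mul (K := 1) fun a b => by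
      simpa only [NNReal.coe_one, one_mul, dist_eq_norm] using hj.norm_sub_le hT hc b a).continuous

/-- **Lemma 2 in function form**: the zeroes of a monotone operator are exactly the fixed points
of its resolvent map, `j z = z ⟺ z ∈ zer T` (`c > 0`). [cite: EcksteinBertsekas1992, §2 Lemma 2] -/
theorem IsResolventMap.apply_eq_self_iff (hj : IsResolventMap c T j) (hT : IsMonotone T)
    (hc : 0 < c) : j z = z ↔ z ∈ zer T := by
  rw [mem_zer_iff_mem_resolvent hc.ne']
  constructor
  · intro h
    have hz := hj z
    rwa [h] at hz
  · intro h; exact hj.apply_eq hT hc h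

/-! ## Theorem 3 (restricted): the relaxed proximal point algorithm [EB92, p. 299] -/

/-- The reflection `2f − I` has the same fixed points as `f` (Lemma 1 (ii) with Lemma 2: the fixed
points of `2J_{cT} − I` are the zeroes of `T`). [cite: EcksteinBertsekas1992, §2 Lemma 2] -/
theorem two_smul_sub_eq_self_iff (f : H → H) :
    (2 : ℝ) • f z - z = z ↔ f z = z := by
  constructor
  · intro h
    have h2 : (2 : ℝ) • f z = (2 : ℝ) • z := by
      rw [sub_eq_iff_eq_add] at h
      rw [h, two_smul]
    exact smul_right_injective H two_ne_zero h2
  · intro h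
    rw [h, two_smul, add_sub_cancel_right]

/-- The relaxed proximal step `(1 − ρ) z + ρ J z` is the Krasnoselskij averaged map of the
REFLECTION `2J − I` with parameter `ρ/2`. [cite: EcksteinBertsekas1992, §3 Thm 3] -/
theorem averagedMap_reflect (j : H → H) (ρ : ℝ) :
    averagedMap (fun z => (2 : ℝ) • j z - z) (ρ / 2) = averagedMap j ρ := by
  funext z
  simp only [averagedMap, smul_sub, smul_smul]
  rw [show ρ / 2 * 2 = ρ by ring, show (1 - ρ / 2 : ℝ) = (1 - ρ) + ρ / 2 by ring, add_smul]
  abel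

/-- Hence the relaxed proximal point iteration `z^{k+1} = (1 − ρ) z^k + ρ J z^k`, i.e.
`kmIter j ρ`, is the Krasnoselskij iteration of `2J − I` with parameter `ρ/2`.
[cite: EcksteinBertsekas1992, §3 Thm 3] -/
theorem kmIter_reflect (j : H → H) (ρ : ℝ) (z₀ : H) :
    kmIter (fun z => (2 : ℝ) • j z - z) (ρ / 2) z₀ = kmIter j ρ z₀ := by
  funext n
  simp only [kmIter, averagedMap_reflect]

/-- **The key estimate in the proof of Theorem 3** (its second display, exact resolvents): for
`z* ∈ zer T`, `T` monotone, `c > 0` and `ρ ≥ 0`,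
`‖(1 − ρ) z + ρ J_{cT} z − z*‖² ≤ ‖z − z*‖² − ρ(2 − ρ)‖z − J_{cT} z‖²` (there `Q = I − J_{cT}`,
`Q z* = 0`, `Q` firmly nonexpansive). [cite: EcksteinBertsekas1992, §3 Thm 3] -/
theorem norm_averagedMap_resolvent_sub_sq_le (hj : IsResolventMap c T j) (hT : IsMonotone T)
    (hc : 0 < c) {zs : H} (hzs : zs ∈ zer T) {ρ : ℝ} (hρ : 0 ≤ ρ) (z : H) :
    ‖averagedMap j ρ z - zs‖ ^ 2 ≤ ‖z - zs‖ ^ 2 - ρ * (2 - ρ) * ‖z - j z‖ ^ 2 := by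
  have hfix : j zs = zs := (hj.apply_eq_self_iff hT hc).2 hzs
  -- `Q = I − j` is firmly nonexpansive and `Q z* = 0`
  have hQ := hj.norm_sub_sub_sq_le_inner hT hc zs z
  rw [hfix, sub_self, sub_zero] at hQ
  have e : averagedMap j ρ z - zs = (z - zs) - ρ • (z - j z) := by
    simp only [averagedMap, sub_smul, one_smul, smul_sub]; abel
  rw [e, norm_sub_sq_real, norm_smul, real_inner_smul_right, Real.norm_eq_abs, abs_of_nonneg hρ,
    mul_pow]
  have h1 : ρ * ‖z - j z‖ ^ 2 ≤ ρ * ⟪z - zs, z - j z⟫ := mul_le_mul_of_nonneg_left hQ hρ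
  nlinarith [h1]

/-- **Theorem 3 (restricted: constant `c > 0`, constant relaxation `ρ ∈ (0, 2)`, exact resolvents,
proper space)**: if the monotone operator `T` (given with its resolvent map `j = J_{cT}`) has a
zero, then the relaxed proximal point iteration `z^{k+1} = (1 − ρ) z^k + ρ J_{cT}(z^k)` converges
to a zero of `T` from every starting point. [cite: EcksteinBertsekas1992, §3 Thm 3] -/
theorem exists_tendsto_kmIter_resolvent [ProperSpace H] (hj : IsResolventMap c T j)
    (hT : IsMonotone T) (hc : 0 < c) (hzer : (zer T).Nonempty) {ρ : ℝ} (hρ0 : 0 < ρ)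
    (hρ2 : ρ < 2) (z₀ : H) : ∃ z ∈ zer T, Tendsto (kmIter j ρ z₀) atTop (𝓝 z) := by
  obtain ⟨p, hp⟩ := hzer
  have hjp : j p = p := (hj.apply_eq_self_iff hT hc).2 hp
  have hR : ∀ x y : H, ‖((2 : ℝ) • j x - x) - ((2 : ℝ) • j y - y)‖ ≤ ‖x - y‖ :=
    fun x y => hj.norm_reflect_sub_le hT hc y x
  have hRp : (2 : ℝ) • j p - p = p := (two_smul_sub_eq_self_iff j).2 hjp
  obtain ⟨q, hq, hlim⟩ := exists_tendsto_kmIter (T := fun z => (2 : ℝ) • j z - z) (t := ρ / 2)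
    hR ⟨p, hRp⟩ (by positivity) (by linarith) z₀
  refine ⟨q, ?_, ?_⟩
  · exact (hj.apply_eq_self_iff hT hc).1 ((two_smul_sub_eq_self_iff j).1 hq)
  · rw [← kmIter_reflect]; exact hlim

end Literature.Analysis.Convex.MonotoneOperator

end
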